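import Mathlib
import HarnessLib
import Summits.NavierStokesRegularity.NavierStokesRegularity.Theorems.UnthreadedRigidityDoorUnthreadedRigiditySpectralEdgeSphereGreen

/-!
# Route `UnthreadedRigidityDoor`, wall item W2 `UnthreadedRigidity` (stmt-NavierStokesRegularity-27585) — LINE g13-2 «EDGE COERCIVITY»
# (ns-idea-6 g13, `EdgeCoercive_sketch.lean` v1.4 §1b): ★ SHARP COERCIVITY `EdgeSharpCoercivity l` (every `l`), VERBATIM
# (sketch-local `edgeForm` / `hessSq` / `gradSq` unfolded), and `EdgeCoercivityConstant l ((12l−2)/(l(l+1)))`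

Seat ns-es-p1 g9.  `(12l−2)·∫_{S²}Φ² ≤ ∫_{S²} 48𝔅_l[Y]·Φ`, `Φ = {Y,|∇Y|²}`.  By the half-Laplacian form (`edgeHalfLaplacian`) this is
`0 ≤ ∫_{S²} Φ·Δ₃Φ dσ` for the smooth function `Φ`, homogeneous of degree `3l−3`.  PROOF WITHOUT SPECTRAL THEORY: (1) the HARMONIC SPLIT
`f = h + |x|²ψ` of a smooth homogeneous `f` of degree `m ≥ 0` (`h = Σₖ aₖ|x|^{2k}Δ₃ᵏf` harmonic, `a₀ = 1`, `aₖ₊₁ = −aₖ/(2(k+1)(2m−2k−1))`, by the iterated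
commutator `Δ₃(|x|^{2k+2}g) = 2(k+1)(2k+2μ+3)|x|^{2k}g + |x|^{2k+2}Δ₃g` from `lap3_normSq_mul`; the sum is finite because `Δ₃ʲf` has degree `m−2j` and a
smooth function homogeneous of negative degree vanishes); (2) by induction on the degree, a harmonic `h` of degree `d` is `L²(S²)`-orthogonal to every
smooth homogeneous `ψ` of degree `< d` (split `ψ` and use `sphereIntegral_harmonic_orthogonal`); (3) by induction on the degree,
`∫_{S²}ΦΔ₃Φ = (4d−2)∫_{S²}ψ² + ∫_{S²}ψΔ₃ψ ≥ 0` for `Φ = h + |x|²ψ` (on `S²`: `Φ = h + ψ`, `Δ₃Φ = (4d−2)ψ + Δ₃ψ`, cross terms vanish by (2)).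

HONEST LABEL: the quantitative form of a rung-line input two levels below W2 (the sketch's INEQ_l sharp form; equality iff `Φ|S² ∈ H_{3l−3}` is NOT
formalised); nothing here bears on `UnthreadedRigidity` (27585), the door Target, W2 or Navier–Stokes regularity; no summit statement is proved.  0 kit.
[folklore; Gauss decomposition of homogeneous polynomials]
-/

noncomputable section

-- the summit and its single sub-problem share the name (CONVENTIONS §1), as in every Theorems file
set_option linter.dupNamespace false

namespace Summit.NavierStokesRegularity.NavierStokesRegularity.Theorems.UnthreadedRigidity.SpectralEdge

open Set Function Filter Topology MeasureTheory
open scoped RealInnerProductSpace ContDiff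
open Literature.Analysis.FluidPDE (sphereIntegral)
open Literature.Analysis.Calculus (sphereIntegral_congr_norm sphereIntegral_sub' sphereIntegral_add_of sphereIntegral_mul_left sphereIntegral_nonneg')
open Summit.NavierStokesRegularity.NavierStokesRegularity.Theorems.UnthreadedRigidity.ProfileHorn (E3)
open Summit.NavierStokesRegularity.NavierStokesRegularity.Theorems.UnthreadedRigidity.VirialHorn

/-! ## §1 Iterated Laplacians of a smooth homogeneous function -/

section Iterates

variable {f g : E3 → ℝ}

/-- the iterated Laplacians of a smooth function are smooth. -/
theorem contDiff_iterate_lap3 (hf : ContDiff ℝ ∞ f) : ∀ j : ℕ, ContDiff ℝ ∞ (lap3^[j] f) := by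
  intro j
  induction j with
  | zero => simpa using hf
  | succ j ih => rw [Function.iterate_succ_apply']; exact contDiff_lap3 ih

/-- the `j`-th iterated Laplacian of a function homogeneous of degree `m` is homogeneous of degree `m − 2j`. -/
theorem iterate_lap3_homogeneous (m : ℤ) (hhom : ∀ c : ℝ, 0 < c → ∀ z : E3, f (c • z) = c ^ m • f z) :
    ∀ (j : ℕ) (c : ℝ), 0 < c → ∀ z : E3, (lap3^[j] f) (c • z) = c ^ (m - 2 * (j : ℤ)) • (lap3^[j] f) z := by
  intro j
  induction j with
  | zero => intro c hc z; simpa using hhom c hc z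
  | succ j ih =>
    intro c hc z
    rw [Function.iterate_succ_apply', lap3_homogeneous (m - 2 * (j : ℤ)) ih c hc z]
    congr 1
    push_cast
    ring_nf

/-- the iterated Laplacians vanish beyond half the degree. -/
theorem iterate_lap3_eq_zero (hf : ContDiff ℝ ∞ f) (m : ℤ) (hhom : ∀ c : ℝ, 0 < c → ∀ z : E3, f (c • z) = c ^ m • f z)
    (j : ℕ) (hj : m - 2 * (j : ℤ) < 0) (x : E3) : (lap3^[j] f) x = 0 :=
  eq_zero_of_homogeneous_neg (contDiff_iterate_lap3 hf j).continuous.continuousAt _ hj (iterate_lap3_homogeneous m hhom j) x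

/-- ★ THE ITERATED COMMUTATOR: for `g ∈ C²` homogeneous of integer degree `μ`,
`Δ₃(|x|^{2(k+1)} g) = 2(k+1)(2k+2μ+3)|x|^{2k} g + |x|^{2(k+1)} Δ₃g`. [folklore] -/
theorem lap3_normSq_pow_succ_mul : ∀ (k : ℕ) (g : E3 → ℝ), ContDiff ℝ 2 g → ∀ μ : ℤ, (∀ c : ℝ, 0 < c → ∀ z : E3, g (c • z) = c ^ μ • g z) →
    ∀ y : E3, lap3 (fun x : E3 => (‖x‖ ^ 2) ^ (k + 1) * g x) y =
      2 * ((k : ℝ) + 1) * (2 * (k : ℝ) + 2 * (μ : ℝ) + 3) * (‖y‖ ^ 2) ^ k * g y + (‖y‖ ^ 2) ^ (k + 1) * lap3 g y := by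
  intro k
  induction k with
  | zero =>
    intro g hg μ hhom y
    have h := lap3_normSq_mul hg μ hhom y
    simp only [zero_add, pow_one, Nat.cast_zero, pow_zero] at h ⊢
    rw [h]; ring
  | succ k ih =>
    intro g hg μ hhom y
    -- `|x|^{2(k+2)} g = |x|² · (|x|^{2(k+1)} g)`, the inner function being homogeneous of degree `μ + 2(k+1)`
    have hG2 : ContDiff ℝ 2 (fun x : E3 => (‖x‖ ^ 2) ^ (k + 1) * g x) := ((contDiff_norm_sq ℝ).pow _).mul hg
    have hGh : ∀ c : ℝ, 0 < c → ∀ z : E3, (fun x : E3 => (‖x‖ ^ 2) ^ (k + 1) * g x) (c • z) =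
        c ^ (μ + 2 * ((k : ℤ) + 1)) • (fun x : E3 => (‖x‖ ^ 2) ^ (k + 1) * g x) z := by
      intro c hc z
      simp only [norm_smul, Real.norm_eq_abs, abs_of_pos hc, hhom c hc z, smul_eq_mul]
      rw [show c ^ (μ + 2 * ((k : ℤ) + 1)) = c ^ μ * c ^ (2 * (k + 1) : ℕ) by
        rw [zpow_add₀ hc.ne', ← zpow_natCast]; push_cast; ring_nf]
      ring
    have hfun : (fun x : E3 => (‖x‖ ^ 2) ^ (k + 1 + 1) * g x) = fun x : E3 => ‖x‖ ^ 2 * ((‖x‖ ^ 2) ^ (k + 1) * g x) := by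
      funext x; ring
    rw [hfun, lap3_normSq_mul hG2 (μ + 2 * ((k : ℤ) + 1)) hGh y, ih g hg μ hhom y]
    push_cast
    ring

/-- `Δ₃` of a finite linear combination of `C²` functions. -/
theorem lap3_sum_range (n : ℕ) (a : ℕ → ℝ) (B : ℕ → E3 → ℝ) (hB : ∀ j, ContDiff ℝ 2 (B j)) (y : E3) :
    lap3 (fun x : E3 => ∑ j ∈ Finset.range n, a j * B j x) y = ∑ j ∈ Finset.range n, a j * lap3 (B j) y := by
  induction n with
  | zero =>
    simp only [Finset.range_zero, Finset.sum_empty]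
    unfold lap3 dir2; simp
  | succ n ih =>
    have hfun : (fun x : E3 => ∑ j ∈ Finset.range (n + 1), a j * B j x) =
        fun x : E3 => (∑ j ∈ Finset.range n, a j * B j x) + a n * B n x := by
      funext x; rw [Finset.sum_range_succ]
    have hS : ContDiff ℝ 2 (fun x : E3 => ∑ j ∈ Finset.range n, a j * B j x) :=
      ContDiff.sum fun j _ => contDiff_const.mul (hB j)
    rw [hfun, lap3_add hS (contDiff_const.mul (hB n)), lap3_const_mul (hB n), ih, Finset.sum_range_succ]

end Iterates

/-! ## §2 The harmonic split `f = h + |x|²ψ` -/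

/-- ★ THE HARMONIC SPLIT (first step of the Gauss decomposition): a smooth `f`, homogeneous of integer degree `m ≥ 0`, is `h + |x|²ψ` with `h` smooth,
HARMONIC and homogeneous of degree `m`, and `ψ` smooth homogeneous of degree `m − 2`. [folklore; Gauss] -/
theorem harmonic_split {f : E3 → ℝ} (hf : ContDiff ℝ ∞ f) (m : ℤ) (hm : 0 ≤ m)
    (hhom : ∀ c : ℝ, 0 < c → ∀ z : E3, f (c • z) = c ^ m • f z) :
    ∃ h ψ : E3 → ℝ, ContDiff ℝ ∞ h ∧ ContDiff ℝ ∞ ψ ∧ (∀ c : ℝ, 0 < c → ∀ z : E3, h (c • z) = c ^ m • h z) ∧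
      (∀ c : ℝ, 0 < c → ∀ z : E3, ψ (c • z) = c ^ (m - 2) • ψ z) ∧ (∀ x : E3, lap3 h x = 0) ∧
      ∀ x : E3, f x = h x + ‖x‖ ^ 2 * ψ x := by
  -- the coefficients
  obtain ⟨a, ha0, haS⟩ : ∃ a : ℕ → ℝ, a 0 = 1 ∧ ∀ j : ℕ, a (j + 1) = -a j / (2 * ((j : ℝ) + 1) * (2 * (m : ℝ) - 2 * (j : ℝ) - 1)) :=
    ⟨fun j => Nat.rec (motive := fun _ => ℝ) 1 (fun j aj => -aj / (2 * ((j : ℝ) + 1) * (2 * (m : ℝ) - 2 * (j : ℝ) - 1))) j, rfl, fun _ => rfl⟩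
  have hden : ∀ j : ℕ, (2 * ((j : ℝ) + 1) * (2 * (m : ℝ) - 2 * (j : ℝ) - 1)) ≠ 0 := by
    intro j
    refine mul_ne_zero (by positivity) ?_
    intro h
    have h2 : (2 * m - 2 * (j : ℤ) - 1 : ℤ) = 0 := by exact_mod_cast h
    omega
  have hrec : ∀ j : ℕ, a j + a (j + 1) * (2 * ((j : ℝ) + 1) * (2 * (m : ℝ) - 2 * (j : ℝ) - 1)) = 0 := by
    intro j; rw [haS j, div_mul_cancel₀ _ (hden j)]; ring
  -- the iterates `D j = Δ₃ʲ f`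
  set D : ℕ → E3 → ℝ := fun j => lap3^[j] f with hD
  have hDs : ∀ j, ContDiff ℝ ∞ (D j) := contDiff_iterate_lap3 hf
  have hDh : ∀ (j : ℕ) (c : ℝ), 0 < c → ∀ z : E3, D j (c • z) = c ^ (m - 2 * (j : ℤ)) • D j z := iterate_lap3_homogeneous m hhom
  have hDsucc : ∀ j, lap3 (D j) = D (j + 1) := fun j => by simp only [hD, Function.iterate_succ_apply']
  -- truncation level `K`: `m − 2K < 0`
  obtain ⟨K, hK⟩ : ∃ K : ℕ, m - 2 * (K : ℤ) < 0 := ⟨m.toNat + 1, by push_cast; omega⟩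
  have hDK : ∀ j : ℕ, K ≤ j → ∀ x, D j x = 0 := fun j hj x =>
    iterate_lap3_eq_zero hf m hhom j (by omega) x
  -- the two functions
  refine ⟨fun x => ∑ j ∈ Finset.range (K + 1), a j * ((‖x‖ ^ 2) ^ j * D j x),
    fun x => -∑ j ∈ Finset.range K, a (j + 1) * ((‖x‖ ^ 2) ^ j * D (j + 1) x), ?_, ?_, ?_, ?_, ?_, ?_⟩
  · exact ContDiff.sum fun j _ => contDiff_const.mul (((contDiff_norm_sq ℝ).pow _).mul (hDs j))
  · exact (ContDiff.sum fun j _ => contDiff_const.mul (((contDiff_norm_sq ℝ).pow _).mul (hDs (j + 1)))).neg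
  · intro c hc z
    beta_reduce
    rw [smul_eq_mul, Finset.mul_sum]
    refine Finset.sum_congr rfl fun j _ => ?_
    rw [norm_smul, Real.norm_eq_abs, abs_of_pos hc, hDh j c hc z, smul_eq_mul]
    have hpow : (c ^ 2) ^ j * c ^ (m - 2 * (j : ℤ)) = c ^ m := by
      rw [← pow_mul, ← zpow_natCast, ← zpow_add₀ hc.ne']; congr 1; push_cast; ring
    calc a j * (((c * ‖z‖) ^ 2) ^ j * (c ^ (m - 2 * (j : ℤ)) * D j z))
        = a j * (((c ^ 2) ^ j * c ^ (m - 2 * (j : ℤ))) * ((‖z‖ ^ 2) ^ j * D j z)) := by ring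
      _ = c ^ m * (a j * ((‖z‖ ^ 2) ^ j * D j z)) := by rw [hpow]; ring
  · intro c hc z
    beta_reduce
    rw [smul_eq_mul, mul_neg, Finset.mul_sum]
    congr 1
    refine Finset.sum_congr rfl fun j _ => ?_
    rw [norm_smul, Real.norm_eq_abs, abs_of_pos hc, hDh (j + 1) c hc z, smul_eq_mul]
    have hpow : (c ^ 2) ^ j * c ^ (m - 2 * ((j + 1 : ℕ) : ℤ)) = c ^ (m - 2) := by
      rw [← pow_mul, ← zpow_natCast, ← zpow_add₀ hc.ne']; congr 1; push_cast; ring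
    calc a (j + 1) * (((c * ‖z‖) ^ 2) ^ j * (c ^ (m - 2 * ((j + 1 : ℕ) : ℤ)) * D (j + 1) z))
        = a (j + 1) * (((c ^ 2) ^ j * c ^ (m - 2 * ((j + 1 : ℕ) : ℤ))) * ((‖z‖ ^ 2) ^ j * D (j + 1) z)) := by ring
      _ = c ^ (m - 2) * (a (j + 1) * ((‖z‖ ^ 2) ^ j * D (j + 1) z)) := by rw [hpow]; ring
  · -- harmonicity
    intro x
    have hB : ∀ j : ℕ, ContDiff ℝ 2 (fun x : E3 => (‖x‖ ^ 2) ^ j * D j x) :=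
      fun j => ((contDiff_norm_sq ℝ).pow _).mul ((hDs j).of_le (by norm_cast))
    rw [lap3_sum_range (K + 1) a (fun j x => (‖x‖ ^ 2) ^ j * D j x) hB x]
    -- `Δ₃(|x|^{2j} D_j)`: `j = 0` and `j + 1`
    have hL0 : lap3 (fun x : E3 => (‖x‖ ^ 2) ^ 0 * D 0 x) x = D 1 x := by
      have : (fun x : E3 => (‖x‖ ^ 2) ^ 0 * D 0 x) = D 0 := funext fun x => by simp
      rw [this, hDsucc 0]
    have hLs : ∀ j : ℕ, lap3 (fun x : E3 => (‖x‖ ^ 2) ^ (j + 1) * D (j + 1) x) x =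
        2 * ((j : ℝ) + 1) * (2 * (m : ℝ) - 2 * (j : ℝ) - 1) * (‖x‖ ^ 2) ^ j * D (j + 1) x + (‖x‖ ^ 2) ^ (j + 1) * D (j + 2) x := by
      intro j
      rw [lap3_normSq_pow_succ_mul j (D (j + 1)) ((hDs (j + 1)).of_le (by norm_cast)) (m - 2 * ((j + 1 : ℕ) : ℤ)) (hDh (j + 1)) x,
        hDsucc (j + 1)]
      push_cast
      ring
    rw [Finset.sum_range_succ', hL0]
    simp only [hLs]
    -- collect: `Σ_{j<K} a(j+1)[c_j r^{2j} D_{j+1} + r^{2j+2} D_{j+2}] + a 0 · D 1 = Σ_{j ≤ K} [a j + a(j+1) c_j] r^{2j} D_{j+1}` (all zero) `− (top term = 0)`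
    have hsplit : ∑ j ∈ Finset.range K, a (j + 1) * (2 * ((j : ℝ) + 1) * (2 * (m : ℝ) - 2 * (j : ℝ) - 1) * (‖x‖ ^ 2) ^ j * D (j + 1) x
          + (‖x‖ ^ 2) ^ (j + 1) * D (j + 2) x)
        = ∑ j ∈ Finset.range K, (a (j + 1) * (2 * ((j : ℝ) + 1) * (2 * (m : ℝ) - 2 * (j : ℝ) - 1))) * ((‖x‖ ^ 2) ^ j * D (j + 1) x)
          + ∑ j ∈ Finset.range K, a (j + 1) * ((‖x‖ ^ 2) ^ (j + 1) * D (j + 2) x) := by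
      rw [← Finset.sum_add_distrib]
      refine Finset.sum_congr rfl fun j _ => ?_
      ring
    rw [hsplit]
    -- shift the second sum: `Σ_{j<K} a(j+1) r^{2(j+1)} D_{j+2} = Σ_{j<K+1} a j r^{2j} D_{j+1} − a 0 · D 1`
    have hshift : ∑ j ∈ Finset.range K, a (j + 1) * ((‖x‖ ^ 2) ^ (j + 1) * D (j + 2) x)
        = ∑ j ∈ Finset.range (K + 1), a j * ((‖x‖ ^ 2) ^ j * D (j + 1) x) - a 0 * D 1 x := by
      rw [Finset.sum_range_succ']
      simp
    rw [hshift]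
    -- now the `j = K` term of the shifted sum vanishes and the rest pairs with the first sum
    rw [Finset.sum_range_succ (fun j => a j * ((‖x‖ ^ 2) ^ j * D (j + 1) x)) K, hDK (K + 1) (by omega) x]
    have hpair : ∑ j ∈ Finset.range K, (a (j + 1) * (2 * ((j : ℝ) + 1) * (2 * (m : ℝ) - 2 * (j : ℝ) - 1))) * ((‖x‖ ^ 2) ^ j * D (j + 1) x)
        + ∑ j ∈ Finset.range K, a j * ((‖x‖ ^ 2) ^ j * D (j + 1) x) = 0 := by
      rw [← Finset.sum_add_distrib]
      refine Finset.sum_eq_zero fun j _ => ?_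
      have h := hrec j
      calc a (j + 1) * (2 * ((j : ℝ) + 1) * (2 * (m : ℝ) - 2 * (j : ℝ) - 1)) * ((‖x‖ ^ 2) ^ j * D (j + 1) x)
            + a j * ((‖x‖ ^ 2) ^ j * D (j + 1) x)
          = (a j + a (j + 1) * (2 * ((j : ℝ) + 1) * (2 * (m : ℝ) - 2 * (j : ℝ) - 1))) * ((‖x‖ ^ 2) ^ j * D (j + 1) x) := by ring
        _ = 0 := by rw [h, zero_mul]
    rw [ha0]
    linear_combination hpair
  · -- `f = h + |x|²ψ`
    intro x
    beta_reduce
    rw [Finset.sum_range_succ', ha0, mul_neg, Finset.mul_sum]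
    simp only [pow_zero, one_mul]
    have : ∑ j ∈ Finset.range K, a (j + 1) * ((‖x‖ ^ 2) ^ (j + 1) * D (j + 1) x)
        = ∑ j ∈ Finset.range K, ‖x‖ ^ 2 * (a (j + 1) * ((‖x‖ ^ 2) ^ j * D (j + 1) x)) :=
      Finset.sum_congr rfl fun j _ => by ring
    rw [this]
    show f x = _
    have hD0 : D 0 x = f x := by simp [hD]
    rw [hD0]
    ring

/-! ## §3 Orthogonality to lower degrees and positivity of `∫_{S²} Φ·Δ₃Φ` -/

/-- a harmonic `h`, smooth and homogeneous of degree `d ≥ 0`, is `L²(S²)`-orthogonal to every smooth `ψ` homogeneous of integer degree `μ < d`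
(induction on `μ` via the harmonic split). [folklore] -/
theorem sphereIntegral_harmonic_mul_lower : ∀ (n : ℕ) (h ψ : E3 → ℝ) (d μ : ℤ), μ ≤ 2 * (n : ℤ) - 3 → 0 ≤ d → μ < d →
    ContDiff ℝ ∞ h → ContDiff ℝ ∞ ψ → (∀ c : ℝ, 0 < c → ∀ z : E3, h (c • z) = c ^ d • h z) →
    (∀ c : ℝ, 0 < c → ∀ z : E3, ψ (c • z) = c ^ μ • ψ z) → (∀ x : E3, lap3 h x = 0) →
    sphereIntegral (volume : Measure E3) (fun x => h x * ψ x) 1 = 0 := by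
  intro n
  induction n with
  | zero =>
    intro h ψ d μ hμ _ _ _ hψ _ hψh _
    have h0 : ∀ x, ψ x = 0 := fun x => eq_zero_of_homogeneous_neg hψ.continuous.continuousAt μ (by omega) hψh x
    simp [h0, Literature.Analysis.FluidPDE.sphereIntegral_def]
  | succ n ih =>
    intro h ψ d μ hμ hd hμd hh hψ hhh hψh hhl
    rcases lt_or_ge μ 0 with hμ0 | hμ0
    · have h0 : ∀ x, ψ x = 0 := fun x => eq_zero_of_homogeneous_neg hψ.continuous.continuousAt μ hμ0 hψh x
      simp [h0, Literature.Analysis.FluidPDE.sphereIntegral_def]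
    · obtain ⟨h', ψ', hh's, hψ's, hh'h, hψ'h, hh'l, hsplit⟩ := harmonic_split hψ μ hμ0 hψh
      -- on the sphere `ψ = h' + ψ'`
      rw [sphereIntegral_congr_norm zero_le_one (g := fun x => h x * h' x + h x * ψ' x) (fun x hx => by rw [hsplit x, hx]; ring)]
      have c1 : ContinuousOn (fun x => h x * h' x) {0}ᶜ := (hh.continuous.mul hh's.continuous).continuousOn
      have c2 : ContinuousOn (fun x => h x * ψ' x) {0}ᶜ := (hh.continuous.mul hψ's.continuous).continuousOn
      rw [sphereIntegral_add_of _ _ c1 c2 one_pos,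
        sphereIntegral_harmonic_orthogonal hh hh's d μ hd hμ0 (ne_of_gt hμd) hhh hh'h hhl hh'l,
        ih h ψ' d (μ - 2) (by omega) hd (by omega) hh hψ's hhh hψ'h hhl, add_zero]

/-- ★ POSITIVITY: for a smooth `Φ` homogeneous of integer degree `d`, `0 ≤ ∫_{S²} Φ·Δ₃Φ dσ` (induction on the degree via the harmonic split;
`= Σₖ 2k(2d−2k+1)‖h_{d−2k}‖²` in terms of the Gauss decomposition). [folklore] -/
theorem sphereIntegral_mul_lap3_nonneg : ∀ (n : ℕ) (Φ : E3 → ℝ) (d : ℤ), d ≤ 2 * (n : ℤ) - 3 → ContDiff ℝ ∞ Φ →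
    (∀ c : ℝ, 0 < c → ∀ z : E3, Φ (c • z) = c ^ d • Φ z) →
    0 ≤ sphereIntegral (volume : Measure E3) (fun x => Φ x * lap3 Φ x) 1 := by
  intro n
  induction n with
  | zero =>
    intro Φ d hd hΦ hΦh
    have h0 : ∀ x, Φ x = 0 := fun x => eq_zero_of_homogeneous_neg hΦ.continuous.continuousAt d (by omega) hΦh x
    simp [h0, Literature.Analysis.FluidPDE.sphereIntegral_def]
  | succ n ih =>
    intro Φ d hd hΦ hΦh
    rcases lt_or_ge d 0 with hd0 | hd0
    · have h0 : ∀ x, Φ x = 0 := fun x => eq_zero_of_homogeneous_neg hΦ.continuous.continuousAt d hd0 hΦh x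
      simp [h0, Literature.Analysis.FluidPDE.sphereIntegral_def]
    obtain ⟨h, ψ, hhs, hψs, hhh, hψh, hhl, hsplit⟩ := harmonic_split hΦ d hd0 hΦh
    -- `Δ₃Φ = (4d−2)ψ + |x|²Δ₃ψ`
    have hfun : Φ = fun x => h x + ‖x‖ ^ 2 * ψ x := funext hsplit
    have hlap : ∀ x : E3, lap3 Φ x = (4 * (d : ℝ) - 2) * ψ x + ‖x‖ ^ 2 * lap3 ψ x := by
      intro x
      rw [hfun, lap3_add (hhs.of_le (by norm_cast)) ((contDiff_norm_sq ℝ).mul (hψs.of_le (by norm_cast))), hhl x,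
        lap3_normSq_mul (hψs.of_le (by norm_cast)) (d - 2) hψh x]
      push_cast; ring
    rcases le_or_gt d 1 with hd1 | hd1
    · -- `d ∈ {0, 1}`: `ψ` has negative degree, `Φ = h` is harmonic
      have hψ0 : ∀ x, ψ x = 0 := fun x => eq_zero_of_homogeneous_neg hψs.continuous.continuousAt (d - 2) (by omega) hψh x
      have hL0 : ∀ x, lap3 Φ x = 0 := by
        intro x
        have hψfun : ψ = fun _ => (0 : ℝ) := funext hψ0
        rw [hlap x, hψ0 x, hψfun]
        unfold lap3 dir2; simp
      simp [hL0, Literature.Analysis.FluidPDE.sphereIntegral_def]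
    · -- `d ≥ 2`: expand on the sphere
      have hI := ih ψ (d - 2) (by omega) hψs hψh
      have cψ : Continuous ψ := hψs.continuous
      have ch : Continuous h := hhs.continuous
      have cL : Continuous (lap3 ψ) := (contDiff_lap3 hψs).continuous
      rw [sphereIntegral_congr_norm zero_le_one
        (g := fun x => ((4 * (d : ℝ) - 2) * (h x * ψ x) + h x * lap3 ψ x) + ((4 * (d : ℝ) - 2) * (ψ x * ψ x) + ψ x * lap3 ψ x))
        (fun x hx => by rw [hsplit x, hlap x, hx]; ring)]
      have c1 : ContinuousOn (fun x => (4 * (d : ℝ) - 2) * (h x * ψ x) + h x * lap3 ψ x) {0}ᶜ :=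
        ((continuous_const.mul (ch.mul cψ)).add (ch.mul cL)).continuousOn
      have c2 : ContinuousOn (fun x => (4 * (d : ℝ) - 2) * (ψ x * ψ x) + ψ x * lap3 ψ x) {0}ᶜ :=
        ((continuous_const.mul (cψ.mul cψ)).add (cψ.mul cL)).continuousOn
      have c3 : ContinuousOn (fun x => (4 * (d : ℝ) - 2) * (h x * ψ x)) {0}ᶜ := (continuous_const.mul (ch.mul cψ)).continuousOn
      have c4 : ContinuousOn (fun x => h x * lap3 ψ x) {0}ᶜ := (ch.mul cL).continuousOn
      have c5 : ContinuousOn (fun x => (4 * (d : ℝ) - 2) * (ψ x * ψ x)) {0}ᶜ := (continuous_const.mul (cψ.mul cψ)).continuousOn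
      have c6 : ContinuousOn (fun x => ψ x * lap3 ψ x) {0}ᶜ := (cψ.mul cL).continuousOn
      rw [sphereIntegral_add_of _ _ c1 c2 one_pos, sphereIntegral_add_of _ _ c3 c4 one_pos, sphereIntegral_add_of _ _ c5 c6 one_pos,
        sphereIntegral_mul_left, sphereIntegral_mul_left]
      -- the cross terms vanish (degrees `d − 2 < d`, `d − 4 < d`)
      have hx1 : sphereIntegral (volume : Measure E3) (fun x => h x * ψ x) 1 = 0 :=
        sphereIntegral_harmonic_mul_lower (n + 1) h ψ d (d - 2) (by omega) hd0 (by omega) hhs hψs hhh hψh hhl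
      have hx2 : sphereIntegral (volume : Measure E3) (fun x => h x * lap3 ψ x) 1 = 0 :=
        sphereIntegral_harmonic_mul_lower (n + 1) h (lap3 ψ) d (d - 2 - 2) (by omega) hd0 (by omega) hhs (contDiff_lap3 hψs) hhh
          (fun c hc z => lap3_homogeneous (d - 2) hψh c hc z) hhl
      rw [hx1, hx2]
      have hsq : 0 ≤ sphereIntegral (volume : Measure E3) (fun x => ψ x * ψ x) 1 := sphereIntegral_nonneg' (fun x => mul_self_nonneg _) 1
      have hc : (0 : ℝ) ≤ 4 * (d : ℝ) - 2 := by
        have : (2 : ℝ) ≤ (d : ℝ) := by exact_mod_cast hd1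
        linarith
      nlinarith

/-! ## §4 ★ `EdgeSharpCoercivity l` and `EdgeCoercivityConstant l ((12l−2)/(l(l+1)))`, VERBATIM, every degree -/

/-- ★ **the sketch's `EdgeSharpCoercivity l` VERBATIM** (sketch-local `edgeForm` / `hessSq` / `gradSq` unfolded), every degree:
`(12l − 2)·∫_{S²} {Y,|∇Y|²}² dσ ≤ ∫_{S²} 48𝔅_l[Y]·{Y,|∇Y|²} dσ` (half-Laplacian form + positivity of `∫_{S²}Φ·Δ₃Φ`). -/
theorem edgeSharpCoercivity (l : ℕ) :
    ∀ Y : E3 → ℝ, IsSolidHarmonic l Y →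
      (12 * (l : ℝ) - 2) * sphereIntegral (volume : Measure E3) (fun y => angForm Y y ^ 2) 1
        ≤ sphereIntegral (volume : Measure E3)
            (fun y => (lap3 (angForm Y) y - (4 * (l : ℝ) ^ 2 - 20 * (l : ℝ) + 6) * angForm Y y
              - 2 * pbr Y (fun z => (∑ i : Fin 3, ‖fderiv ℝ (gradient Y) z (e i)‖ ^ 2)
                  - 2 * ((l : ℝ) - 1) ^ 2 * ‖gradient Y z‖ ^ 2) y) * angForm Y y) 1 := by
  intro Y hY
  have hΦ : ContDiff ℝ ∞ (angForm Y) := ThreadingJets.contDiff_angForm hY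
  have hhom : ∀ c : ℝ, 0 < c → ∀ z : E3, angForm Y (c • z) = c ^ ((3 * l : ℤ) - 3) • angForm Y z := ThreadingJets.angForm_smul' hY
  -- the integrand: `48𝔅·Φ = ½ Φ·Δ₃Φ + (12l−2) Φ²`
  have hint : (fun y => (lap3 (angForm Y) y - (4 * (l : ℝ) ^ 2 - 20 * (l : ℝ) + 6) * angForm Y y
      - 2 * pbr Y (fun z => (∑ i : Fin 3, ‖fderiv ℝ (gradient Y) z (e i)‖ ^ 2) - 2 * ((l : ℝ) - 1) ^ 2 * ‖gradient Y z‖ ^ 2) y)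
        * angForm Y y) =
      fun y => (1 / 2) * (angForm Y y * lap3 (angForm Y) y) + (12 * (l : ℝ) - 2) * angForm Y y ^ 2 := by
    funext y
    rw [edgeHalfLaplacian l Y hY y]
    ring
  rw [hint]
  have cΦ : Continuous (angForm Y) := hΦ.continuous
  have cL : Continuous (lap3 (angForm Y)) := (contDiff_lap3 hΦ).continuous
  have c1 : ContinuousOn (fun y => (1 / 2 : ℝ) * (angForm Y y * lap3 (angForm Y) y)) {0}ᶜ := (continuous_const.mul (cΦ.mul cL)).continuousOn
  have c2 : ContinuousOn (fun y => (12 * (l : ℝ) - 2) * angForm Y y ^ 2) {0}ᶜ := (continuous_const.mul (cΦ.pow 2)).continuousOn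
  rw [sphereIntegral_add_of _ _ c1 c2 one_pos, sphereIntegral_mul_left, sphereIntegral_mul_left]
  have hpos := sphereIntegral_mul_lap3_nonneg (2 * l) (angForm Y) ((3 * l : ℤ) - 3) (by push_cast; omega) hΦ hhom
  nlinarith

/-- ★ **the sketch's `EdgeCoercivityConstant l ((12l−2)/(l(l+1)))` VERBATIM** (`l ≥ 1`): the quantitative INEQ_l with the sharp constant
(the sketch's glue `edgeCoercivityConstant_of_sharp` with `EdgeSharpCoercivity l` discharged). -/
theorem edgeCoercivityConstant (l : ℕ) (hl : 1 ≤ l) :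
    ∀ Y : E3 → ℝ, IsSolidHarmonic l Y →
      (12 * (l : ℝ) - 2) / ((l : ℝ) * ((l : ℝ) + 1)) * ((l : ℝ) * ((l : ℝ) + 1))
          * sphereIntegral (volume : Measure E3) (fun y => angForm Y y ^ 2) 1
        ≤ sphereIntegral (volume : Measure E3)
            (fun y => (lap3 (angForm Y) y - (4 * (l : ℝ) ^ 2 - 20 * (l : ℝ) + 6) * angForm Y y
              - 2 * pbr Y (fun z => (∑ i : Fin 3, ‖fderiv ℝ (gradient Y) z (e i)‖ ^ 2)
                  - 2 * ((l : ℝ) - 1) ^ 2 * ‖gradient Y z‖ ^ 2) y) * angForm Y y) 1 := by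
  intro Y hY
  have hl' : (0 : ℝ) < l := by exact_mod_cast hl
  have hne : (l : ℝ) * ((l : ℝ) + 1) ≠ 0 := mul_ne_zero hl'.ne' (by positivity)
  rw [div_mul_cancel₀ _ hne]
  exact edgeSharpCoercivity l Y hY
end Summit.NavierStokesRegularity.NavierStokesRegularity.Theorems.UnthreadedRigidity.SpectralEdge

end
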